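import Literature.NumberTheory.Automorphic.ParabolicIndGLNoSupercuspidalSubquotient
import Literature.NumberTheory.Automorphic.PrincipalSeriesGL2SatakeParameters
import Literature.NumberTheory.Automorphic.MatrixCoefficients
import HarnessLib

/-!
# R90-TF · S1 #7 helper — the central character of a unitarizable `σ₂ ↪ I(x, y)` on `GL₂(F)` is unitary: `‖x u‖ · ‖y u‖ = 1`

Cell `hodgecm-mathlib`, programme R90-TF, section S1 «Ch10-local», seat R90-C10-p01 (g0); helper for the socket S1#7
`stub_S1_split_parabolicInd_irreducible_of_unitary`, consumed by `Theorems/R90S1SplitInducedIrreducibleBox`.  THEOREMS ONLY (one theorem); no definition,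
no named fact, no `sorry`.  THE MATHEMATICS ([BernsteinZelevinsky1977, §2.3]; [Bump1997, §4.5]): the scalar `u · 1 ∈ GL₂(F)` is central and lies in the Borel; it acts on
`I(x, y) = parabolicIndGL F id (𝟙.twist (tch ![x,y]))` by `δ_B^{1/2}(u·1) · x(u) y(u) = x(u) y(u)` (★ `parabolicIndGL_apply_of_mem_center`, ★
`coe_rootDeltaChar_standardParabolicGL_fin_two`), hence — through an injective intertwiner — on `σ₂` by the same scalar, whose modulus is `1` for an invariant
positive definite Hermitian form.
HONEST LABEL: HC_CM is proved only modulo the 7 printed citations (2 remaining named inputs: hLiu418 = stmt-HodgeConjecture-24832,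
h413 = stmt-HodgeConjecture-24833) until rung 0 closes; count-neutral helper (`--supports stmt-HodgeConjecture-24833 --as helper`).
-/

set_option autoImplicit false
set_option linter.dupNamespace false

noncomputable section

open scoped ComplexConjugate

namespace Summit.HodgeConjecture.HodgeConjecture.R90.S1

open Literature.NumberTheory Literature.NumberTheory.Automorphic

section Central

variable {F : Type} [Field F] [ValuativeRel F] [TopologicalSpace F] [IsNonarchimedeanLocalField F]

/-- **THE CENTRAL CHARACTER OF A UNITARIZABLE SUBREPRESENTATION OF `I(x, y)` IS UNITARY**: if an irreducible `σ₂` on `W ≠ 0` with an invariant positive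
definite Hermitian form embeds into the `GL₂(F)` principal series `I(x,y) = parabolicIndGL F id (𝟙.twist (tch ![x,y]))`, then `‖x u‖ · ‖y u‖ = 1` for every
`u ∈ F^×` (the scalar `u·1` acts on `I(x,y)` by `x(u) y(u)`, `δ_B(u·1) = 1`). [cite: BernsteinZelevinsky1977, §2.3] [cite: Bump1997, §4.5] -/
theorem norm_mul_norm_eq_one_of_injective_principalSeries_two {W : Type} [AddCommGroup W] [Module ℂ W] [Nontrivial W]
    (σ₂ : Representation ℂ (GL (Fin 2) F) W) (hσu : σ₂.IsUnitarizable) (x y : Fˣ →* ℂˣ)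
    (φ : σ₂.IntertwiningMap (Representation.parabolicIndGL F (id : Fin 2 → Fin 2)
      ((Representation.trivial ℂ (Π a : Fin 2, GL {i : Fin 2 // (id : Fin 2 → Fin 2) i = a} F) ℂ).twist
        (∏ a : Fin 2, ((![x, y] : Fin 2 → (Fˣ →* ℂˣ)) a).comp (Matrix.GeneralLinearGroup.det.comp
          (Pi.evalMonoidHom (fun a : Fin 2 => GL {i : Fin 2 // (id : Fin 2 → Fin 2) i = a} F) a))))))
    (hφ : Function.Injective φ) (u : Fˣ) : ‖((x u : ℂˣ) : ℂ)‖ * ‖((y u : ℂˣ) : ℂ)‖ = 1 := by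
  classical
  obtain ⟨B, -, hBp, hBinv⟩ := hσu
  -- the scalar `z = u · 1`
  have hzc : (Matrix.GeneralLinearGroup.scalar (Fin 2) u : GL (Fin 2) F) ∈ Subgroup.center (GL (Fin 2) F) :=
    Subgroup.mem_center_iff.2 fun g => (Matrix.GeneralLinearGroup.scalar_commute u g).symm
  have hzP : (Matrix.GeneralLinearGroup.scalar (Fin 2) u : GL (Fin 2) F) ∈ standardParabolicGL F (id : Fin 2 → Fin 2) := by
    rw [mem_standardParabolicGL_iff]
    intro i j hij
    have hne : i ≠ j := fun h => (lt_irrefl _) (h ▸ hij)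
    rw [Matrix.GeneralLinearGroup.coe_scalar, Matrix.scalar_apply, Matrix.diagonal_apply_ne _ hne]
  -- `z` acts on `I(x,y)` by `δ^{1/2}(z) · tch(proj z)`
  set cz : ℂ := (((∏ a : Fin 2, ((![x, y] : Fin 2 → (Fˣ →* ℂˣ)) a).comp (Matrix.GeneralLinearGroup.det.comp
      (Pi.evalMonoidHom (fun a : Fin 2 => GL {i : Fin 2 // (id : Fin 2 → Fin 2) i = a} F) a)))
      (leviProjection F (id : Fin 2 → Fin 2) ⟨Matrix.GeneralLinearGroup.scalar (Fin 2) u, hzP⟩) : ℂˣ) : ℂ) with hcz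
  have hact := fun f => Literature.NumberTheory.Automorphic.parabolicIndGL_apply_of_mem_center (F := F) (c := (id : Fin 2 → Fin 2))
    (σ := (Representation.trivial ℂ (Π a : Fin 2, GL {i : Fin 2 // (id : Fin 2 → Fin 2) i = a} F) ℂ).twist
      (∏ a : Fin 2, ((![x, y] : Fin 2 → (Fˣ →* ℂˣ)) a).comp (Matrix.GeneralLinearGroup.det.comp
        (Pi.evalMonoidHom (fun a : Fin 2 => GL {i : Fin 2 // (id : Fin 2 → Fin 2) i = a} F) a))))
    hzc hzP (cz := cz) (fun w => by rw [Representation.twist_apply, Representation.trivial_apply]) f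
  -- value of the scalar: `δ^{1/2}(z) = 1`, `tch(proj z) = x u * y u`
  have hδ : ((rootDeltaChar (standardParabolicGL F (id : Fin 2 → Fin 2)) ⟨Matrix.GeneralLinearGroup.scalar (Fin 2) u, hzP⟩ : ℂˣ) : ℂ) = 1 := by
    rw [Literature.NumberTheory.Automorphic.coe_rootDeltaChar_standardParabolicGL_fin_two]
    have h00 : ((Matrix.GeneralLinearGroup.scalar (Fin 2) u : GL (Fin 2) F) : Matrix (Fin 2) (Fin 2) F) 0 0 = u := by
      rw [Matrix.GeneralLinearGroup.coe_scalar, Matrix.scalar_apply, Matrix.diagonal_apply_eq]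
    have h11 : ((Matrix.GeneralLinearGroup.scalar (Fin 2) u : GL (Fin 2) F) : Matrix (Fin 2) (Fin 2) F) 1 1 = u := by
      rw [Matrix.GeneralLinearGroup.coe_scalar, Matrix.scalar_apply, Matrix.diagonal_apply_eq]
    simp [h00, h11]
  have hproj : ∀ a : Fin 2, Matrix.GeneralLinearGroup.det
      (leviProjection F (id : Fin 2 → Fin 2) ⟨Matrix.GeneralLinearGroup.scalar (Fin 2) u, hzP⟩ a) = u := by
    intro a
    haveI : Unique {i : Fin 2 // (id : Fin 2 → Fin 2) i = a} := ⟨⟨⟨a, rfl⟩⟩, fun v => Subtype.ext v.2⟩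
    refine Units.ext ?_
    rw [Matrix.GeneralLinearGroup.val_det_apply, Matrix.det_unique, leviProjection_apply_coe,
      Matrix.GeneralLinearGroup.coe_scalar, Matrix.scalar_apply, Matrix.diagonal_apply_eq]
  have hczval : cz = ((x u : ℂˣ) : ℂ) * ((y u : ℂˣ) : ℂ) := by
    rw [hcz, MonoidHom.finsetProd_apply, Fin.prod_univ_two]
    simp only [MonoidHom.comp_apply, Pi.evalMonoidHom_apply, hproj, Matrix.cons_val_zero, Matrix.cons_val_one,
      Units.val_mul]
  -- the scalar acts on `σ₂` by the same number (`φ` injective)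
  obtain ⟨w, hw⟩ := exists_ne (0 : W)
  have hzw : σ₂ (Matrix.GeneralLinearGroup.scalar (Fin 2) u) w = cz • w := by
    apply hφ
    have h1 := LinearMap.congr_fun (φ.isIntertwining' (Matrix.GeneralLinearGroup.scalar (Fin 2) u)) w
    simp only [LinearMap.coe_comp, Function.comp_apply] at h1
    rw [map_smul]
    change φ (σ₂ (Matrix.GeneralLinearGroup.scalar (Fin 2) u) w) = cz • φ w
    rw [show φ (σ₂ (Matrix.GeneralLinearGroup.scalar (Fin 2) u) w) =
      φ.toLinearMap (σ₂ (Matrix.GeneralLinearGroup.scalar (Fin 2) u) w) from rfl, h1, hact, hδ, one_mul]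
    rfl
  -- unitarity
  have hB := hBinv (Matrix.GeneralLinearGroup.scalar (Fin 2) u) w w
  rw [hzw, LinearMap.map_smulₛₗ₂, LinearMap.map_smul, smul_eq_mul, smul_eq_mul, ← mul_assoc] at hB
  have hBww : B w w ≠ 0 := by
    intro h0
    have := hBp w hw
    rw [h0, Complex.zero_re] at this
    exact lt_irrefl _ this
  have hcc : (starRingEnd ℂ) cz * cz = 1 := by
    have := mul_right_cancel₀ hBww (hB.trans (one_mul _).symm)
    exact this
  have hnorm : ‖cz‖ ^ 2 = 1 := by
    have h := congrArg Complex.re hcc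
    rw [Complex.conj_mul', ← Complex.ofReal_pow, Complex.ofReal_re, Complex.one_re] at h
    exact h
  have hn : ‖cz‖ = 1 := by
    have h0 : 0 ≤ ‖cz‖ := norm_nonneg _
    nlinarith [hnorm, h0]
  rw [hczval, norm_mul] at hn
  exact hn


end Central

end Summit.HodgeConjecture.HodgeConjecture.R90.S1

end
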